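import Summits.RiemannHypothesis.RiemannHypothesis.Theses.ConnesConsaniSemilocal
import Summits.RiemannHypothesis.RiemannHypothesis.Theorems.CCIsolation
import HarnessLib

/-!
# Route «ConnesConsaniSemilocal», item `Assembly` (stmt-RiemannHypothesis-19310): leaf → residual → summit

RH-FREE as an implication (cell `rh-crit`, sub-cell `cc/`, seat `rh-crit-cc-iso`; bears_on: W-C/W-P).  The route's
assembly item records where the Connes–Consani corpus stops: `Assembly := WeilArchPositivity_soninTrace_fine →
IsolatedCC → Summit.RiemannHypothesis` — the RH-FREE rung leaf (CC 2021 eq. (4)) is NOT used; the residual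
`IsolatedCC = ∀ n, weilPropertyP n` (RH-EQUIVALENT, line 1; aside, never a binder) gives the summit by the cited
kernel `ConnesPropertyP.riemannHypothesis_iff_forall_weilPropertyP` (here through
`Theorems.CCIsolation.summit_of_isolatedCC`).  One line; no defs, no facts, standard axioms.
WHAT THIS IS NOT: a proof of any item with content, or a claim about RH — nothing here bears on the truth of RH.
-/

set_option linter.dupNamespace false  -- the mandated namespace repeats `RiemannHypothesis`

namespace Summit.RiemannHypothesis.RiemannHypothesis.Theorems.ConnesConsaniSemilocalAssembly

/-- RH-FREE implication (its second hypothesis is RH-EQUIVALENT; nothing asserted): the route's `Assembly` item —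
leaf (unused) → `∀ n, P(n)` → `Summit.RiemannHypothesis`, by `CCIsolation.summit_of_isolatedCC` (Bombieri's
converse inside the pole-free class, cited). [cite: Bombieri2000Weil, Thm. 2; Connes2026Letter §4.1 p. 17] -/
theorem assembly_proof : Theses.ConnesConsaniSemilocal.Assembly :=
  fun _ h ↦ CCIsolation.summit_of_isolatedCC h

end Summit.RiemannHypothesis.RiemannHypothesis.Theorems.ConnesConsaniSemilocalAssembly
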